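import Summits.CriticalPhenomena.PercolationContinuityZ3.Theorems.FK.BoxClusterSizeTransport
import Summits.CriticalPhenomena.PercolationContinuityZ3.Theorems.FK.PressureQDerivatives
import Summits.CriticalPhenomena.PercolationContinuityZ3.Theorems.FK.LatticeEdgeCounting
import HarnessLib

/-!
# FK-continuity cell, FO-10a: the mean number of open clusters PER SITE of the free box measures converges to the
# free cluster density — `|Λ_N|⁻¹ φ⁰_{Λ_N,p,q}(k(ω)) → κ⁰(p,q) = φ⁰_{p,q}(|C_0|⁻¹)` (Grimmett 2006, (4.81)–(4.83), free side,
# as a two-sided limit and WITHOUT the ergodic theorem)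

Registered R109 (cell INBOX l.7500, 2026-08-25); registry row FO-10a-g341; label CCL-B (coordinator fk-4 g227).
Cell `fk-continuity` (bschramm), row FO-10a (domain-Markov + comparison layer over FO-06); support file for the
FK-continuity transplant (`--supports stmt-CriticalPhenomena-4575`); builds on p205010 (kernel theorem, internal audit
signed; external expert review pending). Pure proofs; no definitions, no named facts, no sorries; `d ≥ 1`.
UNCONDITIONAL finite- and infinite-volume structure; it decides nothing about FH / TP_FK / the value of `p_c(q)`.

Grimmett's proof of Lemma (4.79) bounds the `κ`-derivative of the finite-volume pressure, `|E_Λ|⁻¹ φ^ξ_{Λ,p,q}(k(ω,Λ))`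
((4.72), Thm. (3.73)(a)), through (4.81)–(4.82) and identifies the limit `φ^b_{p,q}(|C_0|⁻¹)` by the ergodic theorem
(4.83). The tree's `BoxClusterCountFree.lean` (KAP-C) has the one-sided bound `|Λ_N| κ⁰ − 1 ≤ E⁰_{Λ_N}[k]`; this file
proves the matching upper bound and hence the LIMIT, for `0 ≤ p ≤ 1`, `q ≥ 1`, `d ≥ 1`:

  `|Λ_N|⁻¹ E⁰_{Λ_N,p,q}[k(ω)] → κ⁰(p,q) = ∫ |C_0|⁻¹ dφ⁰_{p,q}`   (`tendsto_rcExpect_clusterCount_div_card_box_false`).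

Upper bound by DEEP SITES (no ergodic theorem): `k(ω) = Σ_x |C_x|⁻¹` (`ClusterCountInverse`),
`E[|C_x|⁻¹] = 1 − Σ_{k=2}^{|Λ_N|} φ(|C_x| ≥ k)/((k−1)k) ≤ 1 − Σ_{k=2}^{K} φ⁰_{Λ_N}(|C_x| ≥ k)/((k−1)k)`, and for
`x + Λ_m ⊆ Λ_N`, `φ⁰_{Λ_N}(|C_x| ≥ k) ≥ φ⁰_{Λ_m}(|C_0| ≥ k)` (`BoxClusterSizeTransport`); so
`|Λ_N|⁻¹ E⁰_{Λ_N}[k] ≤ 1 − (|Λ_{N−m}|/|Λ_N|) Σ_{k=2}^{K} φ⁰_{Λ_m}(|C_0| ≥ k)/((k−1)k)`, whose right side tends, as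
`N → ∞` then `m → ∞`, to `1 − Σ_{k=2}^{K} φ⁰(|C_0| ≥ k)/((k−1)k) ≤ κ⁰ + 1/K` (`ClusterSizeLocality`).

* `rcExpect_inv_ncard_eq_one_sub_sum`, `rcExpect_inv_ncard_le_one_sub_sum` — per site, any wiring `B`;
* `rcExpect_inv_ncard_false_le_of_deep` — per deep site, free;
* `rcExpect_clusterCount_false_div_le` — `|Λ_N|⁻¹ E⁰_{Λ_N}[k] ≤ 1 − (|Λ_{N−m}|/|Λ_N|)·Σ_{k=2}^{K} φ⁰_{Λ_m}(|C_0| ≥ k)/((k−1)k)`;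
* `eventually_rcExpect_clusterCount_false_div_le` — `∀ ε > 0`, eventually `|Λ_N|⁻¹ E⁰_{Λ_N}[k] ≤ κ⁰ + ε`;
* **`tendsto_rcExpect_clusterCount_div_card_box_false`** — the limit.

## References

* G. Grimmett, *The Random-Cluster Model*, Springer 2006 (`book:grimmett2006-random-cluster-model`): §4.5, Thm. (4.58),
  proof of Lemma (4.79), (4.80)–(4.84) [PDF pp. 93–94]; Thm. (4.19)(a) proof, eq. (4.24). [Grimmett2006]
* G. Grimmett, *Percolation*, 2nd ed., Springer 1999: Thm. (4.2) (number of clusters per vertex), §4.1. [GrimmettPercolation1999]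
-/

noncomputable section

open scoped Classical
open Finset Filter Topology MeasureTheory

namespace Summit.CriticalPhenomena.PercolationContinuityZ3.Theorems.FK

open Literature.Probability.Percolation Literature.Probability.LatticeModels

variable {d : ℕ} {p q : ℝ}

/-! ### Per site: `E^B_{Λ_N}[|C_x|⁻¹]` through the level probabilities `φ^B_{Λ_N}(|C_x| ≥ k)` -/

section PerSite

/-- **`E^B_{Λ_N,p,q}[|C_x|⁻¹] = 1 − Σ_{k=2}^{|Λ_N|} φ^B_{Λ_N,p,q}(|C_x| ≥ k)/((k−1)k)`** for every wired class `B`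
(`0 ≤ p ≤ 1`, `q > 0`). [cite: Grimmett2006, proof of Thm. (4.58), display after (4.82)] -/
theorem rcExpect_inv_ncard_eq_one_sub_sum (hp : p ∈ Set.Icc (0 : ℝ) 1) (hq : 0 < q) {N : ℕ} (B : Set ↥(box d N))
    (x : ↥(box d N)) :
    rcExpect (finsetGraph (zdGraph d) (box d N)) p q B
        (fun ω => (((openCluster (↑ω : BondConfig ↥(box d N)) x).ncard : ℝ))⁻¹) =
      1 - ∑ k ∈ Finset.Icc 2 (Fintype.card ↥(box d N)),
        (rcMeasure (finsetGraph (zdGraph d) (box d N)) p q B).real (clusterSizeGe x k) / (((k : ℝ) - 1) * k) := by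
  set M := Fintype.card ↥(box d N) with hM
  have hfun : (fun ω : Finset (Sym2 ↥(box d N)) => (((openCluster (↑ω : BondConfig ↥(box d N)) x).ncard : ℝ))⁻¹) =
      fun ω : Finset (Sym2 ↥(box d N)) => (1 : ℝ) - ∑ k ∈ Finset.Icc 2 M,
        (1 / (((k : ℝ) - 1) * k)) * (if (↑ω : BondConfig ↥(box d N)) ∈ clusterSizeGe x k then (1 : ℝ) else 0) := by
    funext ω
    rw [inv_ncard_openCluster_eq_one_sub_sum, ← hM]
    refine congrArg (fun t : ℝ => (1 : ℝ) - t) (Finset.sum_congr rfl fun k _ => ?_)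
    split_ifs <;> simp
  rw [hfun, rcExpect_sub, rcExpect_const _ hp hq, rcExpect_finset_sum]
  refine congrArg (fun t : ℝ => (1 : ℝ) - t) (Finset.sum_congr rfl fun k _ => ?_)
  rw [rcExpect_const_mul, rcMeasure_real_eq_rcExpect _ hp hq]
  ring

/-- Truncation: **`E^B_{Λ_N,p,q}[|C_x|⁻¹] ≤ 1 − Σ_{k=2}^{K} φ^B_{Λ_N,p,q}(|C_x| ≥ k)/((k−1)k)`** for `K ≤ |Λ_N|`.
[cite: Grimmett2006, proof of Thm. (4.58), display after (4.82)] -/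
theorem rcExpect_inv_ncard_le_one_sub_sum (hp : p ∈ Set.Icc (0 : ℝ) 1) (hq : 0 < q) {N K : ℕ}
    (hK : K ≤ Fintype.card ↥(box d N)) (B : Set ↥(box d N)) (x : ↥(box d N)) :
    rcExpect (finsetGraph (zdGraph d) (box d N)) p q B
        (fun ω => (((openCluster (↑ω : BondConfig ↥(box d N)) x).ncard : ℝ))⁻¹) ≤
      1 - ∑ k ∈ Finset.Icc 2 K,
        (rcMeasure (finsetGraph (zdGraph d) (box d N)) p q B).real (clusterSizeGe x k) / (((k : ℝ) - 1) * k) := by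
  rw [rcExpect_inv_ncard_eq_one_sub_sum hp hq B x]
  refine sub_le_sub_left (Finset.sum_le_sum_of_subset_of_nonneg (Finset.Icc_subset_Icc_right hK) fun k hk _ => ?_) 1
  have hk2 : (2 : ℝ) ≤ k := by exact_mod_cast (Finset.mem_Icc.1 hk).1
  exact div_nonneg measureReal_nonneg (by nlinarith)

/-- **Per deep site, free: `E⁰_{Λ_N,p,q}[|C_x|⁻¹] ≤ 1 − Σ_{k=2}^{K} φ⁰_{Λ_m,p,q}(|C_0| ≥ k)/((k−1)k)`** for `x + Λ_m ⊆ Λ_N`,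
`K ≤ |Λ_N|` (`0 ≤ p ≤ 1`, `q ≥ 1`). [cite: Grimmett2006, proof of Thm. (4.58), (4.81)–(4.83); Thm. (4.19)(a) eq. (4.24)] -/
theorem rcExpect_inv_ncard_false_le_of_deep (hp : p ∈ Set.Icc (0 : ℝ) 1) (hq : 1 ≤ q) {m N K : ℕ}
    (hK : K ≤ Fintype.card ↥(box d N)) (x : ↥(box d N)) (hx : siteRad (x : Site d) + m ≤ N) :
    rcExpect (finsetGraph (zdGraph d) (box d N)) p q (boxBC d false N)
        (fun ω => (((openCluster (↑ω : BondConfig ↥(box d N)) x).ncard : ℝ))⁻¹) ≤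
      1 - ∑ k ∈ Finset.Icc 2 K,
        (rcBoxMeasure d false p q m).real (clusterSizeGe (⟨0, zero_mem_box d m⟩ : ↥(box d m)) k) / (((k : ℝ) - 1) * k) := by
  have hq0 : 0 < q := one_pos.trans_le hq
  refine (rcExpect_inv_ncard_le_one_sub_sum hp hq0 hK (boxBC d false N) x).trans (sub_le_sub_left ?_ 1)
  refine Finset.sum_le_sum fun k hk => ?_
  have hk2 : (2 : ℝ) ≤ k := by exact_mod_cast (Finset.mem_Icc.1 hk).1
  refine div_le_div_of_nonneg_right ?_ (by nlinarith)
  exact rcBoxMeasure_false_real_clusterSizeGe_center_le hp hq x hx k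

end PerSite

/-! ### The sum over the box -/

section Sum

/-- **`|Λ_N|⁻¹ E⁰_{Λ_N,p,q}[k(ω)] ≤ 1 − (|Λ_{N−m}|/|Λ_N|)·Σ_{k=2}^{K} φ⁰_{Λ_m,p,q}(|C_0| ≥ k)/((k−1)k)`** for `m ≤ N`,
`K ≤ |Λ_N|` (`0 ≤ p ≤ 1`, `q ≥ 1`): sum the per-site bounds, `≤ 1 − S` at the `|Λ_{N−m}|` deep sites and `≤ 1` elsewhere.
[cite: Grimmett2006, proof of Thm. (4.58), (4.81)–(4.83)] -/
theorem rcExpect_clusterCount_false_div_le (hp : p ∈ Set.Icc (0 : ℝ) 1) (hq : 1 ≤ q) {m N K : ℕ} (hmN : m ≤ N)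
    (hK : K ≤ Fintype.card ↥(box d N)) :
    rcExpect (finsetGraph (zdGraph d) (box d N)) p q (boxBC d false N)
        (fun ω => (clusterCount (↑ω : BondConfig ↥(box d N)) (boxBC d false N) : ℝ)) / #(box d N) ≤
      1 - (#(box d (N - m)) : ℝ) / #(box d N) * ∑ k ∈ Finset.Icc 2 K,
        (rcBoxMeasure d false p q m).real (clusterSizeGe (⟨0, zero_mem_box d m⟩ : ↥(box d m)) k) / (((k : ℝ) - 1) * k) := by
  have hq0 : 0 < q := one_pos.trans_le hq
  set S := ∑ k ∈ Finset.Icc 2 K,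
    (rcBoxMeasure d false p q m).real (clusterSizeGe (⟨0, zero_mem_box d m⟩ : ↥(box d m)) k) / (((k : ℝ) - 1) * k) with hS
  have hcardpos : (0 : ℝ) < #(box d N) := by exact_mod_cast Finset.card_pos.2 (box_nonempty d N)
  have hfree : boxBC d false N = (∅ : Set ↥(box d N)) := rfl
  -- `k(ω) = Σ_x |C_x|⁻¹`
  have hk : (fun ω : Finset (Sym2 ↥(box d N)) => (clusterCount (↑ω : BondConfig ↥(box d N)) (boxBC d false N) : ℝ)) =
      fun ω : Finset (Sym2 ↥(box d N)) =>
        ∑ x : ↥(box d N), (((openCluster (↑ω : BondConfig ↥(box d N)) x).ncard : ℝ))⁻¹ := by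
    funext ω
    rw [hfree, clusterCount_empty_eq_sum_inv_ncard_openCluster]
  rw [hk, rcExpect_finset_sum]
  -- per-site bounds: `≤ 1 − S` on deep sites, `≤ 1` everywhere
  set D : Finset ↥(box d N) := Finset.univ.filter fun x : ↥(box d N) => (x : Site d) ∈ box d (N - m) with hD
  have hle : ∀ x : ↥(box d N),
      rcExpect (finsetGraph (zdGraph d) (box d N)) p q (boxBC d false N)
          (fun ω => (((openCluster (↑ω : BondConfig ↥(box d N)) x).ncard : ℝ))⁻¹) ≤
        1 - (if x ∈ D then S else 0) := by
    intro x
    by_cases hx : x ∈ D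
    · rw [if_pos hx]
      have hx' : (x : Site d) ∈ box d (N - m) := (Finset.mem_filter.1 hx).2
      exact rcExpect_inv_ncard_false_le_of_deep hp hq hK x (siteRad_add_le_of_mem_box_sub hmN hx')
    · rw [if_neg hx, sub_zero]
      have h := rcExpect_inv_ncard_le_one_sub_sum hp hq0 (Nat.zero_le _) (boxBC d false N) x
      simpa using h
  have hsum := Finset.sum_le_sum fun x (_ : x ∈ (Finset.univ : Finset ↥(box d N))) => hle x
  rw [Finset.sum_sub_distrib, Finset.sum_const, Finset.card_univ, Fintype.card_coe, nsmul_eq_mul, mul_one,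
    ← Finset.sum_filter, Finset.sum_const] at hsum
  have hDcard : #(Finset.univ.filter fun x : ↥(box d N) => x ∈ D) = #(box d (N - m)) := by
    rw [← card_filter_coe_mem_box_sub m N, ← hD]
    congr 1
    ext x
    simp
  rw [hDcard, nsmul_eq_mul] at hsum
  rw [div_le_iff₀ hcardpos]
  have h2 : (1 - (#(box d (N - m)) : ℝ) / #(box d N) * S) * #(box d N) = #(box d N) - #(box d (N - m)) * S := by
    rw [sub_mul, one_mul, mul_right_comm, div_mul_cancel₀ _ hcardpos.ne']
  rw [h2]
  exact hsum

end Sum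

/-! ### The limit -/

section Limit

/-- **Upper bound in the limit: for every `ε > 0`, eventually `|Λ_N|⁻¹ E⁰_{Λ_N,p,q}[k(ω)] ≤ κ⁰(p,q) + ε`** (`d ≥ 1`,
`0 ≤ p ≤ 1`, `q ≥ 1`; `κ⁰(p,q) = ∫ |C_0|⁻¹ dφ⁰_{p,q}`). Choose `K` with `1/K ≤ ε`, then `m` with
`Σ_{k=2}^{K} φ⁰_{Λ_m}(|C_0| ≥ k)/((k−1)k) ≥ Σ_{k=2}^{K} φ⁰(|C_0| ≥ k)/((k−1)k) − ε`, then `N` large.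
[cite: Grimmett2006, proof of Thm. (4.58), (4.81)–(4.83)] -/
theorem eventually_rcExpect_clusterCount_false_div_le (hd : 0 < d) (hp : p ∈ Set.Icc (0 : ℝ) 1) (hq : 1 ≤ q)
    {ε : ℝ} (hε : 0 < ε) :
    ∀ᶠ N : ℕ in atTop, rcExpect (finsetGraph (zdGraph d) (box d N)) p q (boxBC d false N)
        (fun ω => (clusterCount (↑ω : BondConfig ↥(box d N)) (boxBC d false N) : ℝ)) / #(box d N) ≤
      ∫ ω, ((openCluster ω (0 : Site d)).ncard : ℝ)⁻¹ ∂(rcLimit d false p q) + ε := by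
  haveI := isProbabilityMeasure_rcLimit (d := d) false p q
  set κ₀ := ∫ ω, ((openCluster ω (0 : Site d)).ncard : ℝ)⁻¹ ∂(rcLimit d false p q) with hκ₀
  -- `K` with `1/K ≤ ε/3`
  obtain ⟨K₀, hK₀⟩ := exists_nat_one_div_lt (show 0 < ε / 3 by positivity)
  set K := K₀ + 1 with hK
  have hK1 : 1 ≤ K := by omega
  have hKε : (1 : ℝ) / K ≤ ε / 3 := by rw [hK]; push_cast; exact hK₀.le
  -- the infinite-volume truncation
  set Sinf := ∑ k ∈ Finset.Icc 2 K, (rcLimit d false p q).real (clusterSizeGe (0 : Site d) k) / (((k : ℝ) - 1) * k)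
    with hSinf
  have hinf : 1 - Sinf ≤ κ₀ + ε / 3 := by
    have h := (abs_le.1 (abs_integral_inv_ncard_sub_le (rcLimit d false p q) (0 : Site d) K hK1)).1
    rw [← hSinf] at h
    linarith
  -- `m` with `S m ≥ Sinf − ε/3`
  set S : ℕ → ℝ := fun m => ∑ k ∈ Finset.Icc 2 K,
    (rcBoxMeasure d false p q m).real (clusterSizeGe (⟨0, zero_mem_box d m⟩ : ↥(box d m)) k) / (((k : ℝ) - 1) * k)
    with hSdef
  have hSlim : Tendsto S atTop (𝓝 Sinf) :=
    tendsto_finsetSum _ fun k _ => (tendsto_rcBoxMeasure_real_clusterSizeGe_center false hp hq k).div_const _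
  obtain ⟨m, hm⟩ := ((Metric.tendsto_nhds.1 hSlim) (ε / 3) (by positivity)).exists
  have hm' : Sinf - ε / 3 ≤ S m := by
    rw [Real.dist_eq] at hm
    have := (abs_lt.1 hm).1
    linarith
  have hS1 : S m ≤ 1 := by
    haveI := isProbabilityMeasure_rcBoxMeasure false hp (one_pos.trans_le hq) m (d := d)
    exact sum_Icc_measureReal_div_le_one _ _ K
  have hS0 : 0 ≤ S m := Finset.sum_nonneg fun k hk => by
    have hk2 : (2 : ℝ) ≤ k := by exact_mod_cast (Finset.mem_Icc.1 hk).1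
    exact div_nonneg measureReal_nonneg (by nlinarith)
  -- `N` large: `N ≥ m`, `K ≤ |Λ_N|`, `|Λ_{N−m}|/|Λ_N| ≥ 1 − ε/3`
  have hratio : ∀ᶠ N : ℕ in atTop, 1 - ε / 3 ≤ (#(box d (N - m)) : ℝ) / #(box d N) := by
    have h := tendsto_card_box_sub_div_card_box (d := d) m
    exact (h.eventually (eventually_ge_nhds (show 1 - ε / 3 < (1 : ℝ) by linarith))).mono fun N hN => hN
  have hKN : ∀ᶠ N : ℕ in atTop, K ≤ Fintype.card ↥(box d N) := by
    filter_upwards [eventually_ge_atTop K] with N hN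
    rw [Fintype.card_coe, card_box]
    calc K ≤ N := hN
      _ ≤ 2 * N + 1 := by omega
      _ ≤ (2 * N + 1) ^ d := Nat.le_self_pow hd.ne' _
  filter_upwards [hratio, hKN, eventually_ge_atTop m] with N hrN hKN' hmN
  have hmain := rcExpect_clusterCount_false_div_le hp hq hmN hKN' (K := K)
  have hr1 : (#(box d (N - m)) : ℝ) / #(box d N) ≤ 1 := by
    have hpos : (0 : ℝ) < #(box d N) := by exact_mod_cast Finset.card_pos.2 (box_nonempty d N)
    rw [div_le_one hpos]
    exact_mod_cast Finset.card_le_card (box_mono d (Nat.sub_le N m))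
  -- `1 − r S ≤ 1 − (1 − ε/3) S ≤ 1 − S + ε/3 ≤ 1 − Sinf + 2ε/3 ≤ κ₀ + ε`
  have h1 : 1 - (#(box d (N - m)) : ℝ) / #(box d N) * S m ≤ 1 - S m + ε / 3 := by nlinarith
  linarith

/-- **Grimmett 2006, (4.81)–(4.83), free boundary condition, as a limit: the mean number of open clusters per site
of the free box measures converges to the free cluster density,
`|Λ_N|⁻¹ E⁰_{Λ_N,p,q}[k(ω)] → κ⁰(p,q) = ∫ |C_0|⁻¹ dφ⁰_{p,q}`** (`d ≥ 1`, `0 ≤ p ≤ 1`, `q ≥ 1`; no ergodic theorem: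
the lower bound is `BoxClusterCountFree`, the upper bound the deep-site comparison of this file).
[cite: Grimmett2006, proof of Thm. (4.58) and of Lemma (4.79), (4.80)–(4.84)] -/
theorem tendsto_rcExpect_clusterCount_div_card_box_false (hd : 0 < d) (hp : p ∈ Set.Icc (0 : ℝ) 1) (hq : 1 ≤ q) :
    Tendsto (fun N : ℕ => rcExpect (finsetGraph (zdGraph d) (box d N)) p q (boxBC d false N)
        (fun ω => (clusterCount (↑ω : BondConfig ↥(box d N)) (boxBC d false N) : ℝ)) / #(box d N)) atTop
      (𝓝 (∫ ω, ((openCluster ω (0 : Site d)).ncard : ℝ)⁻¹ ∂(rcLimit d false p q))) := by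
  set κ₀ := ∫ ω, ((openCluster ω (0 : Site d)).ncard : ℝ)⁻¹ ∂(rcLimit d false p q) with hκ₀
  rw [tendsto_order]
  refine ⟨fun a ha => ?_, fun b hb => ?_⟩
  · have hδ : 0 < (κ₀ - a) / 2 := by linarith
    filter_upwards [eventually_integral_sub_le_rcExpect_clusterCount_div hd hp hq hδ] with N hN
    linarith
  · have hε : 0 < (b - κ₀) / 2 := by linarith
    filter_upwards [eventually_rcExpect_clusterCount_false_div_le hd hp hq hε] with N hN
    linarith

end Limit

end Summit.CriticalPhenomena.PercolationContinuityZ3.Theorems.FK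

end
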